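import Summits.Ventures.CertifiedQuantumChemistry.Certificates.H8RingSto3gR0707FastVector
import HarnessLib

/-!
# Ventures/CertifiedQuantumChemistry — Certificates/H8RingSto3gR0707FastRows2.lean: row chunks part 2 of 5 of the kernel
# discharge of `cert_h8ringsto3gr0707_fci_r103_upper` (H₈ ring STO-3G, sector `(4,4)`)

HONEST FRAMING (verbatim): certified bounds for a stated model Hamiltonian in a stated basis; not a
claim about the real molecule beyond that model.

var-2 (gen 16), zero compute. PART 2 of 5 (part 1 = `…FastRows.lean` with the table agreement and the mask checks;
the discharge = `…FastUpper.lean`). Machinery: `Rows/OccupationBitmasks.lean`,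
`Rows/OccupationVectorMasks.lean`, `Rows/SlaterCondonFast.lean`, `Rows/CIFastRows.lean` (var-2 g16); data:
`Certificates/H8RingSto3gR0707FastTables.lean` / `…FastVector.lean`. Contents: the row inequalities `fastRow i ≤ R_i` of the upper-triangle Rayleigh
numerator (`Rows/CIFastRows.lean`) for the chunks `[144,175)`, `[175,208)`, `[208,242)`, `[242,279)`, `[279,315)`, each ONE `decide +kernel`
(≈ 96 s of kernel time on the farm in this file). Decided facts only; no claim node; 0 sorry.
-/

set_option linter.style.longLine false

namespace Summit.Ventures.CertifiedQuantumChemistry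

namespace Certificates

set_option maxHeartbeats 100000000 in
/-- Rows `144 ≤ i < 175`: `fastRow i ≤ R_i` (in fact `=`); ONE `decide +kernel` (cost units 51834). -/
theorem h8f_rows_144_175 : ∀ i < 175, 144 ≤ i → h8fT.fastRow h8fMask h8fCoef 1196 i ≤ h8fR i := by
  decide +kernel

set_option maxHeartbeats 100000000 in
/-- Rows `175 ≤ i < 208`: `fastRow i ≤ R_i` (in fact `=`); ONE `decide +kernel` (cost units 51474). -/
theorem h8f_rows_175_208 : ∀ i < 208, 175 ≤ i → h8fT.fastRow h8fMask h8fCoef 1196 i ≤ h8fR i := by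
  decide +kernel

set_option maxHeartbeats 100000000 in
/-- Rows `208 ≤ i < 242`: `fastRow i ≤ R_i` (in fact `=`); ONE `decide +kernel` (cost units 51729). -/
theorem h8f_rows_208_242 : ∀ i < 242, 208 ≤ i → h8fT.fastRow h8fMask h8fCoef 1196 i ≤ h8fR i := by
  decide +kernel

set_option maxHeartbeats 100000000 in
/-- Rows `242 ≤ i < 279`: `fastRow i ≤ R_i` (in fact `=`); ONE `decide +kernel` (cost units 52322). -/
theorem h8f_rows_242_279 : ∀ i < 279, 242 ≤ i → h8fT.fastRow h8fMask h8fCoef 1196 i ≤ h8fR i := by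
  decide +kernel

set_option maxHeartbeats 100000000 in
/-- Rows `279 ≤ i < 315`: `fastRow i ≤ R_i` (in fact `=`); ONE `decide +kernel` (cost units 51564). -/
theorem h8f_rows_279_315 : ∀ i < 315, 279 ≤ i → h8fT.fastRow h8fMask h8fCoef 1196 i ≤ h8fR i := by
  decide +kernel

end Certificates

end Summit.Ventures.CertifiedQuantumChemistry
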